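/-
Copyright (c) 2026 the pub-hodgecm-mathlib formalisation cell (harness21).  Prover seat hodgecm-mathlib-K2E3-p23 (g6), HCML Track B «K2-LIT» ∕ h413
(`stmt-HodgeConjecture-24833`), line `K2_E3_EllipticInputs`, road «GL₂-sc» (road owner K2E5-p17 (g5), dealer K2E3-plan (g4)), NON-ELLIPTIC half, brick 2N-2,
FILE 3 OF 3 (VOL-split₂): the `Fin 2` twin of ★ VOL-split `K2E3GL3SplitConjugacyVolume` (K2E3-p14 (g5)) — the Haar volume of
`{z ∈ GL₂(F) : h(det z) ∈ W, 𝔅_{R'}(z), 𝔅_m(z t z⁻¹)}` is `≤ C(m) · |W|(2R'+1) · |t₀ − t₁|_F⁻¹`.  2026-09-04.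
-/
import Summits.HodgeConjecture.HodgeConjecture.Theorems.K2E3GLnKNAIntegration                    -- ★ (V1) p858137 (K2E3-p14 g5), generic `n`: `∫_{GL_n} f = C ∫_K ∫_N ∫_A f(kna)`
import Summits.HodgeConjecture.HodgeConjecture.Theorems.K2E3GL2SplitShearCount                    -- ★ (V2₂) (this seat): the `N = 2` shear count, `N`-box finite
import Summits.HodgeConjecture.HodgeConjecture.Theorems.K2E3GL2TorusWindowCount                   -- ★ (V3₂) p858931 (this seat): the torus window count, `A(𝒪)` finite
import Summits.HodgeConjecture.HodgeConjecture.Theorems.K2E3GL2ModUniformizerFundamentalDomain    -- ★ 2N-0c F1 p858834 (this seat): `log_v_det_mul`, `isClopen_preimage_log_v_det`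
import HarnessLib

/-!
# Road «GL₂-sc», non-elliptic half, brick 2N-2 (VOL-split₂): the Haar volume of `{z : h(det z) ∈ W, 𝔅_{R'}(z), 𝔅_m(z t z⁻¹)}` is `≤ C(m) · |W|(2R'+1) · |t₀−t₁|⁻¹`

Cell `pub/hodgecm-mathlib` (D-0151), Track B «K2-LIT», crux H413 = `stmt-HodgeConjecture-24833`, route of record `HCCMUnconditional`.  Lane
`--supports stmt-HodgeConjecture-24833 --as helper`; THEOREMS ONLY (no `def`, no `instance`, no `notation`, no named-fact hypothesis, no `sorry`); count-neutral.
`Fin 2` reading of ★ VOL-split (K2E3-p14 (g5), road «GL-[M6]-sc» BLUEPRINT v4 §2).  Harish-Chandra's ball bound `hball` of the Theorem 16 route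
[HarishChandra1970, Part VII §3 pp. 71–73] for a SPLIT-regular class of `GL₂(F)` is a direct Haar-volume count in the Iwasawa order `z = k · n · a` (★ V1, no modulus
factor): for `t = diag(t₀,t₁)` with distinct integral entries, a finite window `W` of determinant heights (`h(z) = log v(det z)`), a radius `R'` and the support radius `m`:
  **`ν {z : h(det z) ∈ W ∧ 𝔅_{R'}(z) ∧ 𝔅_m(z t z⁻¹)} ≤ C(m) · |W|·(2R'+1) · |t₀−t₁|_F⁻¹`**   (`exists_measure_window_adBall_conj_le`),
with `C(m) = c_{KNA} · κ(K) · α(A(𝒪)) · μ_N(N-box m) < ∞` a LOCAL constant (★ V2₂ `measure_nBox_lt_top`, ★ V3₂ `measure_setOf_coe_mem_glInt_lt_top`).  In the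
coordinates `z = k n a`: the height window and `𝔅_{R'}(z)` constrain only `a` (`h(det kna) = h(det a)`; `𝔅_{R'}(kna) ⇒ 𝔅_{R'}(a)` by ★ V0), giving the factor
`|W|(2R'+1) α(A(𝒪))` (★ V3₂, LINEAR in `R'`); the conjugation condition constrains only `n` (`(kna) t (kna)⁻¹ = k (n t n⁻¹) k⁻¹`, `a` commutes with `t`, `𝔅` is
`K`-bi-invariant), giving `|t₀ − t₁|⁻¹ μ_N(N-box m)` by the shear count ★ V2₂ — `|D(t)|^{−1∕2}` in `t`.
§1 `glDiagonal_mem_standardLeviGL_id`, `conj_kna_eq`, `log_v_det_eq_zero_of_mem_glInt`, `log_v_det_eq_zero_of_mem_unipotent`, `log_v_det_kna`; §2 the count.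
HONEST LABEL: HC_CM is proved only modulo the 7 printed citations (2 remaining named inputs: hLiu418 = stmt-HodgeConjecture-24832, h413 =
stmt-HodgeConjecture-24833) until rung 0 closes; count-neutral helper.

## References
* [HarishChandra1970] Harish-Chandra (notes by G. van Dijk), *Harmonic Analysis on Reductive p-adic Groups*, LNM 162 (1970), Part VII §3 pp. 71–73.
* [Gelbart1975] S. Gelbart, *Automorphic forms on adele groups* (1975), Thm. 9.22 (iii) (`dg = dk dn da`).
-/

set_option linter.dupNamespace false

noncomputable section

open MeasureTheory Measure Set Function Topology
open scoped MatrixGroups NNReal ENNReal WithZero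
open Matrix ValuativeRel
open Literature.NumberTheory.Automorphic Literature.NumberTheory.GaloisRepresentations Literature.NumberTheory.GaloisRepresentations.IsNonarchimedeanLocalField
open Summit.HodgeConjecture.HodgeConjecture.Cruxes.H413.K2E3GLnAdHeightBalls Summit.HodgeConjecture.HodgeConjecture.Cruxes.H413.K2E3GLnUnipotentAdHeight
open Summit.HodgeConjecture.HodgeConjecture.Cruxes.H413.K2E3GLnKNAIntegration Summit.HodgeConjecture.HodgeConjecture.Cruxes.H413.K2E3GL2SplitShearCount
open Summit.HodgeConjecture.HodgeConjecture.Cruxes.H413.K2E3GL2TorusWindowCount Summit.HodgeConjecture.HodgeConjecture.Cruxes.H413.K2E3GL2ModUniformizerFundamentalDomain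

namespace Summit.HodgeConjecture.HodgeConjecture.Cruxes.H413.K2E3GL2SplitConjugacyVolume

variable {F : Type*} [Field F] [Valued F ℤᵐ⁰] [ValuativeRel F] [(Valued.v : Valuation F ℤᵐ⁰).Compatible] [IsNonarchimedeanLocalField F]

/-! ## §1 The coordinate readings in `z = k · n · a` -/

omit [Valued F ℤᵐ⁰] [ValuativeRel F] [(Valued.v : Valuation F ℤᵐ⁰).Compatible] [IsNonarchimedeanLocalField F] in
/-- `diag(t) ∈ A = M_id`. [folklore] -/
theorem glDiagonal_mem_standardLeviGL_id (t : Fin 2 → Fˣ) : glDiagonal 2 F t ∈ standardLeviGL F (id : Fin 2 → Fin 2) := by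
  rw [mem_standardLeviGL_id_iff]
  intro i j hij
  rw [coe_glDiagonal, Matrix.diagonal_apply_ne _ hij]

omit [Valued F ℤᵐ⁰] [ValuativeRel F] [(Valued.v : Valuation F ℤᵐ⁰).Compatible] [IsNonarchimedeanLocalField F] in
/-- **The conjugation condition sees only `n`**: `(k n a) t (k n a)⁻¹ = k · (n t n⁻¹) · k⁻¹` for `a, t ∈ A` (commutative ★). [cite: HarishChandra1970, Part VII §3 p. 72] -/
theorem conj_kna_eq (k n : GL (Fin 2) F) {a t : GL (Fin 2) F} (ha : a ∈ standardLeviGL F (id : Fin 2 → Fin 2)) (ht : t ∈ standardLeviGL F (id : Fin 2 → Fin 2)) :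
    k * n * a * t * (k * n * a)⁻¹ = k * (n * t * n⁻¹) * k⁻¹ := by
  have hat : a * t = t * a := mul_comm_of_mem_standardLeviGL_id ha ht
  simp only [_root_.mul_inv_rev, mul_assoc]
  rw [← mul_assoc a t, hat, mul_assoc t, mul_inv_cancel_left]

omit [IsNonarchimedeanLocalField F] in
/-- `h(det k) = 0` for `k ∈ GL₂(𝒪)` (`|det k| = 1` ★). [folklore] -/
theorem log_v_det_eq_zero_of_mem_glInt {k : GL (Fin 2) F} (hk : k ∈ glInt 2 F) : WithZero.log (Valued.v (k : Matrix (Fin 2) (Fin 2) F).det) = 0 := by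
  rw [(v_eq_one_iff_valuation_eq_one _).2 (valuation_det_eq_one_of_mem_glInt hk), WithZero.log_one]

omit [ValuativeRel F] [(Valued.v : Valuation F ℤᵐ⁰).Compatible] [IsNonarchimedeanLocalField F] in
/-- `h(det n) = 0` for `n ∈ N₂` (`det n = 1`). [folklore] -/
theorem log_v_det_eq_zero_of_mem_unipotent {n : GL (Fin 2) F} (hn : n ∈ unipotentRadicalGL F (id : Fin 2 → Fin 2)) :
    WithZero.log (Valued.v (n : Matrix (Fin 2) (Fin 2) F).det) = 0 := by
  have hbt : (n : Matrix (Fin 2) (Fin 2) F).BlockTriangular (id : Fin 2 → Fin 2) := ((mem_unipotentRadicalGL_iff_entry (R := F) (c := (id : Fin 2 → Fin 2)) n).1 hn).1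
  rw [Matrix.det_of_upperTriangular hbt, Finset.prod_eq_one fun i _ => apply_self_eq_one_of_mem hn i, map_one, WithZero.log_one]

omit [IsNonarchimedeanLocalField F] in
/-- **The height window sees only `a`**: `h(det (k n a)) = h(det a)` for `k ∈ GL₂(𝒪)`, `n ∈ N₂`. [cite: HarishChandra1970, Part VII §3 p. 72] -/
theorem log_v_det_kna {k n a : GL (Fin 2) F} (hk : k ∈ glInt 2 F) (hn : n ∈ unipotentRadicalGL F (id : Fin 2 → Fin 2)) :
    WithZero.log (Valued.v ((k * n * a : GL (Fin 2) F) : Matrix (Fin 2) (Fin 2) F).det) = WithZero.log (Valued.v (a : Matrix (Fin 2) (Fin 2) F).det) := by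
  rw [log_v_det_mul, log_v_det_mul, log_v_det_eq_zero_of_mem_glInt hk, log_v_det_eq_zero_of_mem_unipotent hn, zero_add, zero_add]

/-! ## §2 The volume count -/

/-- **VOL-split — THE HAAR VOLUME OF `{z : h(det z) ∈ W ∧ 𝔅_{R'}(z) ∧ 𝔅_m(z t z⁻¹)}`** (BLUEPRINT v4 §2): for every Haar measure `ν` on `GL₂(F)` there is a LOCAL
constant `C(m) < ∞` such that for every `t = diag(t₀,t₁)` with distinct integral entries, every finite window `W` of determinant heights and all `R', m`:
`ν {…} ≤ C(m) · (|W|·(2R'+1)) · |t₀−t₁|_F⁻¹` — the `k·n·a` count: ★ V1 (no modulus), the `a`-range is the torus window ★ V3 (polynomial in `R'`), the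
`n`-range is the shear count ★ V2 (`|D|^{−1∕2}`), the `k`-range is all of the compact `K`. [cite: HarishChandra1970, Part VII §3 p. 72] [cite: Gelbart1975, Thm. 9.22 (iii)] -/
theorem exists_measure_window_adBall_conj_le [MeasurableSpace (GL (Fin 2) F)] [BorelSpace (GL (Fin 2) F)]
    {ϖ : F} (hϖ : Valued.v ϖ = WithZero.exp (-1 : ℤ)) (ν : Measure (GL (Fin 2) F)) [IsHaarMeasure ν] :
    ∃ C : ℕ → ℝ≥0∞, (∀ m, C m ≠ ⊤) ∧ ∀ (t : Fin 2 → Fˣ), (t 0 : F) ≠ t 1 → (∀ i, Valued.v (t i : F) ≤ 1) →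
      ∀ (W : Finset ℤ) (R' m : ℕ),
        ν {z : GL (Fin 2) F | WithZero.log (Valued.v (z : Matrix (Fin 2) (Fin 2) F).det) ∈ W ∧
            (∀ i j k l, Valued.v (ϖ ^ R' * ((z : Matrix (Fin 2) (Fin 2) F) i j * ((z⁻¹ : GL (Fin 2) F) : Matrix (Fin 2) (Fin 2) F) k l)) ≤ 1) ∧
            ∀ i j k l, Valued.v (ϖ ^ m * (((z * glDiagonal 2 F t * z⁻¹ : GL (Fin 2) F) : Matrix (Fin 2) (Fin 2) F) i j *
              (((z * glDiagonal 2 F t * z⁻¹)⁻¹ : GL (Fin 2) F) : Matrix (Fin 2) (Fin 2) F) k l)) ≤ 1} ≤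
          C m * ((W.card * (2 * R' + 1) : ℕ) : ℝ≥0∞) * ((normAbs F ((t 0 : F) - t 1))⁻¹ : ℝ≥0) := by
  classical
  -- point-set ∕ measure-theoretic instances
  haveI : T2Space F := (isLocalField F).toT2Space
  haveI : SecondCountableTopology F := secondCountableTopology_localField F
  haveI : LocallyCompactSpace F := (isLocalField F).toLocallyCompactSpace
  haveI : IsTopologicalRing F := inferInstance
  haveI : SecondCountableTopology (Matrix (Fin 2) (Fin 2) F) := inferInstanceAs (SecondCountableTopology (Fin 2 → Fin 2 → F))
  haveI : SecondCountableTopology (Matrix (Fin 2) (Fin 2) F)ᵐᵒᵖ := MulOpposite.opHomeomorph.symm.secondCountableTopology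
  haveI : SecondCountableTopology (GL (Fin 2) F) := Units.isEmbedding_embedProduct.secondCountableTopology
  haveI : LocallyCompactSpace (Matrix (Fin 2) (Fin 2) F) := inferInstanceAs (LocallyCompactSpace (Fin 2 → Fin 2 → F))
  haveI : LocallyCompactSpace (GL (Fin 2) F) := inferInstance
  haveI : LocallyCompactSpace ↥(standardLeviGL F (id : Fin 2 → Fin 2)) := (isClosed_standardLeviGL (R := F) (id : Fin 2 → Fin 2)).locallyCompactSpace
  haveI : LocallyCompactSpace ↥(unipotentRadicalGL F (id : Fin 2 → Fin 2)) := (isClosed_unipotentRadicalGL (R := F) (id : Fin 2 → Fin 2)).locallyCompactSpace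
  haveI : LocallyCompactSpace ↥(glInt 2 F) := (isCompact_glInt 2 F).isClosed.locallyCompactSpace
  haveI : BorelSpace ↥(standardLeviGL F (id : Fin 2 → Fin 2)) := Subtype.borelSpace _
  haveI : BorelSpace ↥(glInt 2 F) := Subtype.borelSpace _
  haveI : BorelSpace ↥(unipotentRadicalGL F (id : Fin 2 → Fin 2)) := Subtype.borelSpace _
  haveI : CompactSpace ↥(glInt 2 F) := isCompact_iff_compactSpace.1 (isCompact_glInt 2 F)
  -- the three auxiliary Haar measures
  set κ : Measure ↥(glInt 2 F) := Measure.haar with hκ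
  set μN : Measure ↥(unipotentRadicalGL F (id : Fin 2 → Fin 2)) := Measure.haar with hμN
  set α : Measure ↥(standardLeviGL F (id : Fin 2 → Fin 2)) := Measure.haar with hα
  haveI : IsFiniteMeasure κ := CompactSpace.isFiniteMeasure
  obtain ⟨c, hc, hKNA⟩ := GLn.exists_lintegral_eq_mul_lintegral_KNA ν κ μN α
  -- the local constant
  refine ⟨fun m => (c : ℝ≥0∞) * κ Set.univ * (α {a | (a : GL (Fin 2) F) ∈ glInt 2 F} *
      μN {n | ∀ i j, Valued.v (ϖ ^ m * ((n : GL (Fin 2) F) : Matrix (Fin 2) (Fin 2) F) i j) ≤ 1}), fun m => ?_, ?_⟩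
  · exact ENNReal.mul_ne_top (ENNReal.mul_ne_top ENNReal.coe_ne_top (measure_ne_top κ _))
      (ENNReal.mul_ne_top (measure_setOf_coe_mem_glInt_lt_top α).ne (measure_nBox_lt_top hϖ m μN).ne)
  intro t h01 ht1 W R' m
  set γ : GL (Fin 2) F := glDiagonal 2 F t with hγ
  have hγA : γ ∈ standardLeviGL F (id : Fin 2 → Fin 2) := glDiagonal_mem_standardLeviGL_id t
  -- the set and its measurability
  set S : Set (GL (Fin 2) F) := {z : GL (Fin 2) F | WithZero.log (Valued.v (z : Matrix (Fin 2) (Fin 2) F).det) ∈ W ∧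
      (∀ i j k l, Valued.v (ϖ ^ R' * ((z : Matrix (Fin 2) (Fin 2) F) i j * ((z⁻¹ : GL (Fin 2) F) : Matrix (Fin 2) (Fin 2) F) k l)) ≤ 1) ∧
      ∀ i j k l, Valued.v (ϖ ^ m * (((z * γ * z⁻¹ : GL (Fin 2) F) : Matrix (Fin 2) (Fin 2) F) i j *
        (((z * γ * z⁻¹)⁻¹ : GL (Fin 2) F) : Matrix (Fin 2) (Fin 2) F) k l)) ≤ 1} with hSdef
  have hconj : Continuous fun z : GL (Fin 2) F => z * γ * z⁻¹ := (continuous_id.mul continuous_const).mul continuous_id.inv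
  have hS : MeasurableSet S := by
    rw [hSdef, Set.setOf_and, Set.setOf_and]
    exact (isClopen_preimage_log_v_det hϖ (W : Set ℤ)).isOpen.measurableSet.inter
      ((isOpen_setOf_adBall ϖ R').measurableSet.inter (((isOpen_setOf_adBall ϖ m).preimage hconj).measurableSet))
  -- the `n`-set and the `a`-set
  set Nset : Set ↥(unipotentRadicalGL F (id : Fin 2 → Fin 2)) := {n | ∀ i j k l, Valued.v (ϖ ^ m *
      ((((n : GL (Fin 2) F) * γ * ((n : GL (Fin 2) F))⁻¹ : GL (Fin 2) F) : Matrix (Fin 2) (Fin 2) F) i j *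
        ((((n : GL (Fin 2) F) * γ * ((n : GL (Fin 2) F))⁻¹)⁻¹ : GL (Fin 2) F) : Matrix (Fin 2) (Fin 2) F) k l)) ≤ 1} with hNset
  set Aset : Set ↥(standardLeviGL F (id : Fin 2 → Fin 2)) := {a | WithZero.log (Valued.v ((a : GL (Fin 2) F) : Matrix (Fin 2) (Fin 2) F).det) ∈ W ∧
      ∀ i j k l, Valued.v (ϖ ^ R' * (((a : GL (Fin 2) F) : Matrix (Fin 2) (Fin 2) F) i j * (((a : GL (Fin 2) F)⁻¹ : GL (Fin 2) F) : Matrix (Fin 2) (Fin 2) F) k l)) ≤ 1}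
    with hAset
  have hAm : MeasurableSet Aset := by
    rw [hAset, Set.setOf_and]
    exact ((isClopen_preimage_log_v_det hϖ (W : Set ℤ)).isOpen.measurableSet.preimage measurable_subtype_coe).inter
      ((isOpen_setOf_adBall ϖ R').measurableSet.preimage measurable_subtype_coe)
  -- the pointwise reading in `z = k n a`
  have hpt : ∀ (k : ↥(glInt 2 F)) (n : ↥(unipotentRadicalGL F (id : Fin 2 → Fin 2))) (a : ↥(standardLeviGL F (id : Fin 2 → Fin 2))),
      S.indicator (fun _ => (1 : ℝ≥0∞)) ((k : GL (Fin 2) F) * (n : GL (Fin 2) F) * (a : GL (Fin 2) F)) ≤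
        Nset.indicator (fun _ => (1 : ℝ≥0∞)) n * Aset.indicator (fun _ => (1 : ℝ≥0∞)) a := by
    intro k n a
    by_cases hz : (k : GL (Fin 2) F) * (n : GL (Fin 2) F) * (a : GL (Fin 2) F) ∈ S
    · obtain ⟨hzW, hzB, hzC⟩ := hz
      obtain ⟨hk1, hk2⟩ := (mem_glInt_iff_forall_v_le_one (k : GL (Fin 2) F)).1 k.2
      have hk3 : ∀ i j, Valued.v ((((k : GL (Fin 2) F)⁻¹⁻¹ : GL (Fin 2) F) : Matrix (Fin 2) (Fin 2) F) i j) ≤ 1 := by rw [inv_inv]; exact hk1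
      have hnN : n ∈ Nset := by
        rw [hNset, Set.mem_setOf_eq]
        rw [conj_kna_eq (k : GL (Fin 2) F) (n : GL (Fin 2) F) a.2 hγA] at hzC
        exact (adBall_mul_left_iff ϖ m hk1 hk2 _).1 ((adBall_mul_right_iff ϖ m hk2 hk3 _).1 hzC)
      have haA : a ∈ Aset := by
        refine ⟨?_, ?_⟩
        · rwa [log_v_det_kna k.2 n.2] at hzW
        · rw [mul_assoc] at hzB
          have hna := (adBall_mul_left_iff ϖ R' hk1 hk2 _).1 hzB
          have hu' : ∀ j, ((((n : GL (Fin 2) F))⁻¹ : GL (Fin 2) F) : Matrix (Fin 2) (Fin 2) F) j j = 1 := fun j => by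
            rw [← Subgroup.coe_inv]; exact apply_self_eq_one_of_mem (n⁻¹).2 j
          exact adBall_diagonal_of_adBall_unipotent_mul (coe_eq_diagonal a) (apply_self_eq_one_of_mem n.2) hu' hna
      rw [Set.indicator_of_mem (show (k : GL (Fin 2) F) * (n : GL (Fin 2) F) * (a : GL (Fin 2) F) ∈ S from ⟨hzW, hzB, hzC⟩),
        Set.indicator_of_mem hnN, Set.indicator_of_mem haA, one_mul]
    · rw [Set.indicator_of_notMem hz]; exact zero_le
  -- integrate: `a`, then `n`, then `k`
  have hA := measure_window_adBall_le α hϖ W R'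
  have hN := measure_setOf_adBall_conj_diagonal_le μN t h01 ht1 ϖ m
  have e0 : ν S = ∫⁻ z, S.indicator (fun _ => (1 : ℝ≥0∞)) z ∂ν := (lintegral_indicator_one hS).symm
  rw [e0, hKNA _ (measurable_const.indicator hS)]
  have hinner : ∀ (k : ↥(glInt 2 F)) (n : ↥(unipotentRadicalGL F (id : Fin 2 → Fin 2))),
      ∫⁻ a, S.indicator (fun _ => (1 : ℝ≥0∞)) ((k : GL (Fin 2) F) * (n : GL (Fin 2) F) * (a : GL (Fin 2) F)) ∂α ≤
        Nset.indicator (fun _ => (1 : ℝ≥0∞)) n * α Aset := by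
    intro k n
    calc ∫⁻ a, S.indicator (fun _ => (1 : ℝ≥0∞)) ((k : GL (Fin 2) F) * (n : GL (Fin 2) F) * (a : GL (Fin 2) F)) ∂α
        ≤ ∫⁻ a, Nset.indicator (fun _ => (1 : ℝ≥0∞)) n * Aset.indicator (fun _ => (1 : ℝ≥0∞)) a ∂α := lintegral_mono fun a => hpt k n a
      _ = Nset.indicator (fun _ => (1 : ℝ≥0∞)) n * α Aset := by
          rw [lintegral_const_mul' _ _ (by rw [Set.indicator_apply]; split_ifs <;> simp), lintegral_indicator_const hAm, one_mul]
  have hNm : MeasurableSet Nset := by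
    have hc : Continuous fun n : ↥(unipotentRadicalGL F (id : Fin 2 → Fin 2)) => (n : GL (Fin 2) F) * γ * ((n : GL (Fin 2) F))⁻¹ :=
      (continuous_subtype_val.mul continuous_const).mul continuous_subtype_val.inv
    exact ((isOpen_setOf_adBall ϖ m).preimage hc).measurableSet
  have hmid : ∀ k : ↥(glInt 2 F),
      ∫⁻ n, ∫⁻ a, S.indicator (fun _ => (1 : ℝ≥0∞)) ((k : GL (Fin 2) F) * (n : GL (Fin 2) F) * (a : GL (Fin 2) F)) ∂α ∂μN ≤ μN Nset * α Aset := by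
    intro k
    calc ∫⁻ n, ∫⁻ a, S.indicator (fun _ => (1 : ℝ≥0∞)) ((k : GL (Fin 2) F) * (n : GL (Fin 2) F) * (a : GL (Fin 2) F)) ∂α ∂μN
        ≤ ∫⁻ n, Nset.indicator (fun _ => (1 : ℝ≥0∞)) n * α Aset ∂μN := lintegral_mono fun n => hinner k n
      _ = μN Nset * α Aset := by rw [lintegral_mul_const _ (measurable_const.indicator hNm), lintegral_indicator_const hNm, one_mul]
  -- assemble
  beta_reduce
  calc (c : ℝ≥0∞) * ∫⁻ k, ∫⁻ n, ∫⁻ a, S.indicator (fun _ => (1 : ℝ≥0∞)) ((k : GL (Fin 2) F) * (n : GL (Fin 2) F) * (a : GL (Fin 2) F)) ∂α ∂μN ∂κ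
      ≤ (c : ℝ≥0∞) * ∫⁻ _k : ↥(glInt 2 F), μN Nset * α Aset ∂κ := mul_le_mul_right (lintegral_mono fun k => hmid k) _
    _ = (c : ℝ≥0∞) * (μN Nset * α Aset * κ Set.univ) := by rw [lintegral_const]
    _ ≤ (c : ℝ≥0∞) * (((((normAbs F ((t 0 : F) - t 1))⁻¹ : ℝ≥0) : ℝ≥0∞) *
          μN {n | ∀ i j, Valued.v (ϖ ^ m * ((n : GL (Fin 2) F) : Matrix (Fin 2) (Fin 2) F) i j) ≤ 1}) *
          (((W.card * (2 * R' + 1) : ℕ) : ℝ≥0∞) * α {a | (a : GL (Fin 2) F) ∈ glInt 2 F}) * κ Set.univ) :=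
        mul_le_mul_right (mul_le_mul_left (mul_le_mul' hN hA) _) _
    _ = (c : ℝ≥0∞) * κ Set.univ * (α {a | (a : GL (Fin 2) F) ∈ glInt 2 F} *
          μN {n | ∀ i j, Valued.v (ϖ ^ m * ((n : GL (Fin 2) F) : Matrix (Fin 2) (Fin 2) F) i j) ≤ 1}) *
          ((W.card * (2 * R' + 1) : ℕ) : ℝ≥0∞) *
          (((normAbs F ((t 0 : F) - t 1))⁻¹ : ℝ≥0) : ℝ≥0∞) := by ring

end Summit.HodgeConjecture.HodgeConjecture.Cruxes.H413.K2E3GL2SplitConjugacyVolume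

end
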